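import Literature.AlgebraicGeometry.Motives.ProjBaseChangeAny
import Literature.AlgebraicGeometry.Motives.BaseChangeProofs
import Literature.AlgebraicGeometry.Motives.SegreEmbedding
import HarnessLib

/-!
# `U × ℙⁿ_k` for an affine `k`-scheme `U`: recognising a product from an isomorphism with `ℙⁿ_{Γ(U, 𝒪)}`

Liu, *Algebraic Geometry and Arithmetic Curves*, Example 3.1.10: `(ℙⁿ_A)_C = ℙⁿ_C`, i.e.
`ℙⁿ_S = ℙⁿ_k ×_{Spec k} Spec S` for every `k`-algebra `S` (the tree's
`ProjBaseChangeRing.isPullback_projMap'`, `Motives/ProjBaseChangeAny`). Packaged for the category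
`SchemeOver k = Over (Spec k)` with its cartesian monoidal structure: if `U` is a `k`-scheme with affine
underlying scheme, `S = Γ(U, 𝒪)`, and a `k`-scheme `E` with a `k`-morphism `g : E → U` has underlying
scheme isomorphic to `ℙⁿ_S = Proj S[T₀, …, Tₙ]` compatibly with `g` and `U ≅ Spec S`, then
`E ≅ U × ℙⁿ_k` over `U` (`exists_iso_tensor_projectiveSpace_of_iso_proj`). This is the step from
"the exceptional divisor over an affine piece `U` of the centre is `ℙⁿ_{Γ(U,𝒪)}`" (Hartshorne II
Thm. 8.24 (b), affine form) to its Zariski-local triviality `E|_U ≅ U × ℙⁿ`.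

## References

* [Liu2002] Q. Liu, Algebraic Geometry and Arithmetic Curves (2002), Prop. 3.1.9, Ex. 3.1.10.
* [GortzWedhorn2020] U. Görtz, T. Wedhorn, Algebraic Geometry I, 2nd ed. (2020), (13.9).
* [Hartshorne1977] R. Hartshorne, Algebraic Geometry (1977), II Thm. 8.24 (b).
-/

noncomputable section

open CategoryTheory CategoryTheory.Limits AlgebraicGeometry MonoidalCategory CartesianMonoidalCategory
open Literature.AlgebraicGeometry.Motives.Segre Literature.AlgebraicGeometry.Motives.ProjBaseChangeRing

attribute [local instance] MvPolynomial.gradedAlgebra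

namespace Literature.AlgebraicGeometry.Motives

universe u

/-- **`E ≅ U × ℙⁿ_k` from `E ≅ ℙⁿ_{Γ(U, 𝒪)}` for `U` affine** (Liu Ex. 3.1.10 `ℙⁿ_S = ℙⁿ_k ×_k Spec S`,
in `SchemeOver k`): given a `k`-morphism `g : E → U` with `U` affine, `S = Γ(U, 𝒪)`, and an isomorphism
`φ : E ≅ Proj S[T₀, …, Tₙ]` of schemes with `φ ≫ (ℙⁿ_S → Spec S) = g ≫ (U → Spec S)`, there is an
isomorphism `E ≅ U × ℙⁿ_k` of `k`-schemes whose first component is `g`.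
[cite: Liu2002, Prop. 3.1.9 and Ex. 3.1.10] [cite: GortzWedhorn2020, (13.9)] -/
theorem exists_iso_tensor_projectiveSpace_of_iso_proj {k : Type u} [Field k] {n : ℕ}
    {EO UO : SchemeOver k} [IsAffine UO.left] (g : EO ⟶ UO)
    (φ : EO.left ≅ Proj (grading (Fin (n + 1)) Γ(UO.left, ⊤)))
    (hφ : φ.hom ≫ toSpec (Fin (n + 1)) Γ(UO.left, ⊤) = g.left ≫ UO.left.toSpecΓ) :
    ∃ ψ : EO ≅ UO ⊗ projectiveSpace n k, ψ.hom ≫ fst UO (projectiveSpace n k) = g := by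
  let S : Type u := Γ(UO.left, ⊤)
  letI : Algebra k S := (pull UO.hom).toAlgebra
  have hS : UO.left.toSpecΓ ≫ Spec.map (CommRingCat.ofHom (algebraMap k S)) = UO.hom :=
    toSpecΓ_SpecMap_pull UO.hom
  have hP := isPullback_projMap' k S (n := n)
  have hφ' : φ.hom ≫ projToSpec (Fin (n + 1)) S = g.left ≫ UO.left.toSpecΓ := hφ
  -- the `k`-morphism `E → ℙⁿ_S → ℙⁿ_k`
  have hcomm : (φ.hom ≫ Proj.map (mapGraded k S (Fin (n + 1))) (irrelevant_le_map k S (Fin (n + 1)))) ≫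
      (projectiveSpace n k).hom = EO.hom := by
    rw [projectiveSpace_hom_eq_projToSpec, Category.assoc, hP.w, ← Category.assoc, hφ', Category.assoc,
      hS, Over.w g]
  let h : EO ⟶ projectiveSpace n k :=
    Over.homMk (φ.hom ≫ Proj.map (mapGraded k S (Fin (n + 1))) (irrelevant_le_map k S (Fin (n + 1)))) hcomm
  let Φ : EO ⟶ UO ⊗ projectiveSpace n k := lift g h
  -- the square `(g, h; U → Spec k, ℙⁿ_k → Spec k)` is cartesian: it is `ℙⁿ_S = ℙⁿ_k ×_k Spec S`
  -- transported along `φ` and `U ≅ Spec S`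
  have hE : IsPullback g.left h.left UO.hom (projectiveSpace n k).hom := by
    refine hP.flip.of_iso φ.symm UO.left.isoSpec.symm (Iso.refl _) (Iso.refl _) ?_ ?_ ?_ ?_
    · rw [Iso.symm_hom, Iso.symm_hom, Iso.eq_inv_comp, ← Category.assoc, hφ', Category.assoc]
      change g.left ≫ UO.left.isoSpec.hom ≫ UO.left.isoSpec.inv = g.left
      rw [Iso.hom_inv_id, Category.comp_id]
    · change Proj.map _ _ ≫ 𝟙 _ = φ.inv ≫ φ.hom ≫ Proj.map _ _
      rw [Category.comp_id, Iso.inv_hom_id_assoc]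
    · rw [Iso.refl_hom, Category.comp_id, Iso.symm_hom, Iso.eq_inv_comp]
      exact hS
    · rw [Iso.refl_hom, Iso.refl_hom, Category.comp_id]
      exact (Category.id_comp (projectiveSpace n k).hom).symm
  -- hence `Φ.left` is the canonical isomorphism onto the chosen pullback
  have hΦ : Φ.left = hE.isoPullback.hom := by
    apply pullback.hom_ext
    · rw [IsPullback.isoPullback_hom_fst]
      exact congrArg (fun t ↦ t.left) (lift_fst g h)
    · rw [IsPullback.isoPullback_hom_snd]
      exact congrArg (fun t ↦ t.left) (lift_snd g h)
  haveI : IsIso Φ.left := by rw [hΦ]; infer_instance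
  haveI : IsIso ((Over.forget _).map Φ) := inferInstanceAs (IsIso Φ.left)
  haveI : IsIso Φ := isIso_of_reflects_iso Φ (Over.forget _)
  exact ⟨asIso Φ, lift_fst g h⟩

end Literature.AlgebraicGeometry.Motives

end
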